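import Summits.CriticalPhenomena.PercolationContinuityZ3.Theorems.TallClusterMassBound.Negative.FalseWithoutCriticality
import Literature.Probability.Percolation.UniversalTightness
import Literature.Probability.Percolation.HalfSpaceFloorDilution
import HarnessLib

/-!
# `TallClusterMassBound` (stmt-CriticalPhenomena-0912), line `SketchIdeator4` — the open stub C⁺ is FALSE WITHOUT
# CRITICALITY: at `p = 1` the typical maximum of the induced half-space percolation in the half-box is `|Λ_r| + 1`

Negative-side helper for the one open registered stub `stub_halfBoxTypicalMax` of the skeleton
`Cruxes/TallClusterMassBound/Lines/SketchIdeator4.lean` (crux `…Theses.PercLowPointHalfSpace.TallClusterMassBound`,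
item B of route PercLowPointHalfSpace):

  `∃ s < 11/4, ∃ C, ∀ r ≥ 1, typicalMax (floorDilutedPercolation 3 (criticalProbI 3) 1) (halfBox r) ≤ C r^s`.

The standard tightness test of a stub — replace `p_c` by `p = 1` — kills it, with room to spare:

* `boxEdges_subset_halfSpaceEdgeSet` : the lattice edges of the half-box `Λ_r = B_r ∩ ℍ` are half-space edges, so under
  `P^ℍ_{1,1} = floorDilutedPercolation 3 1 1` each has weight `1` and
  `real_boxEdges_subset_one` : `P^ℍ_{1,1}(all edges of Λ_r open) = 1`;
* `clusterCapIn_halfBox_eq_card_of_boxEdges` : on that event `|K_0 ∩ Λ_r| = |Λ_r|`, hence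
  `real_card_le_clusterMaxIn_one` : `P^ℍ_{1,1}(|K_max(Λ_r)| ≥ |Λ_r|) = 1`;
* `typicalMax_halfBox_one` : **`typicalMax P^ℍ_{1,1} Λ_r = |Λ_r| + 1`** (`> e^{-1}`-quantile of a sure variable);
* `not_halfBoxTypicalMax_one` : `typicalMax P^ℍ_{1,1} Λ_r ≤ C r^s` for all `r ≥ 1` is false for every `s < 3`
  (`|Λ_r| + 1 ≥ (r+1)³`), and `stub_halfBoxTypicalMax_false_without_criticality` : the stub's `∃ s < 11/4 …` shape with
  `p_c` replaced by `1` is false.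

So C⁺ carries ALL the criticality of the line (ARROW 1, `stub_massLeTypicalMaxLog`, holds at every `p`), matching
`Negative.tallClusterMassBound_false_without_criticality` for the crux itself. Nothing here asserts a Theses statement;
no definitions.
-/

noncomputable section

open MeasureTheory Finset
open Literature.Probability.Percolation Literature.Probability.LatticeModels
open Summit.CriticalPhenomena.PercolationContinuityZ3.Theorems.TallClusterMassBound.Negative

namespace Summit.CriticalPhenomena.PercolationContinuityZ3.Theorems.TallClusterMassBound.TightnessLine

/-- The lattice edges of the half-box are half-space edges (both endpoints in `ℍ`). [folklore] -/
theorem boxEdges_subset_halfSpaceEdgeSet (r : ℕ) :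
    (↑(boxEdges r) : Set (Sym2 V3)) ⊆ halfSpaceEdgeSet 3 := by
  intro e he
  have heE : e ∈ (zdGraph 3).edgeSet := boxEdges_subset_edgeSet r he
  rw [Finset.mem_coe, boxEdges, Finset.mem_image] at he
  obtain ⟨⟨x, y⟩, hxy, rfl⟩ := he
  obtain ⟨hx, hy⟩ := Finset.mem_product.1 (Finset.mem_filter.1 hxy).1
  exact mem_halfSpaceEdgeSet_of_mem_sym2
    (Set.mk_mem_sym2_iff.2 ⟨(Finset.mem_filter.1 hx).2, (Finset.mem_filter.1 hy).2⟩) heE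

/-- At `p = 1`, `s = 1` every half-box edge is open almost surely: `P^ℍ_{1,1}(boxEdges r ⊆ ω) = 1`. [folklore] -/
theorem real_boxEdges_subset_one (r : ℕ) :
    (floorDilutedPercolation 3 1 1).real {ω | (↑(boxEdges r) : Set (Sym2 V3)) ⊆ ω} = 1 := by
  rw [floorDilutedPercolation, prodBernoulli_real_subset]
  refine Finset.prod_eq_one fun e he => ?_
  rw [floorDilutedParam_one_of_mem_halfSpaceEdgeSet 1 (boxEdges_subset_halfSpaceEdgeSet r he)]
  rfl

/-- If all half-box edges are open then the open cluster of `0` contains the whole half-box: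
`|K_0 ∩ Λ_r| = |Λ_r|`. [folklore] -/
theorem clusterCapIn_halfBox_eq_card_of_boxEdges {ω : BondConfig V3} {r : ℕ}
    (hω : (↑(boxEdges r) : Set (Sym2 V3)) ⊆ ω) : clusterCapIn (halfBox r) ω 0 = (halfBox r).card := by
  classical
  rw [clusterCapIn_eq]
  congr 1
  refine Finset.filter_true_of_mem fun x hx => ?_
  exact ((reachable_zero_of_boxEdges hω hx).mono inf_le_left).symm

/-- At `p = 1`, `s = 1`: `P^ℍ_{1,1}(|K_max(Λ_r)| ≥ |Λ_r|) = 1`. [folklore] -/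
theorem real_card_le_clusterMaxIn_one (r : ℕ) :
    (floorDilutedPercolation 3 1 1).real {ω | (halfBox r).card ≤ clusterMaxIn (halfBox r) ω} = 1 := by
  refine le_antisymm measureReal_le_one ?_
  rw [← real_boxEdges_subset_one r]
  refine measureReal_mono (fun ω hω => ?_) (measure_ne_top _ _)
  have h0 : (0 : V3) ∈ halfBox r := by
    rw [halfBox, Finset.mem_filter, mem_box]
    exact ⟨fun i => by simp, le_rfl⟩
  calc (halfBox r).card = clusterCapIn (halfBox r) ω 0 := (clusterCapIn_halfBox_eq_card_of_boxEdges hω).symm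
    _ ≤ clusterMaxIn (halfBox r) ω := clusterCapIn_le_clusterMaxIn h0 ω

/-- **At `p = 1` the typical maximum of the half-box is `|Λ_r| + 1`**: the maximum cluster size is surely `|Λ_r|`,
so `P(|K_max| ≥ n) = 1 > e^{-1}` for every `n ≤ |Λ_r|`. [folklore] -/
theorem typicalMax_halfBox_one (r : ℕ) :
    typicalMax (floorDilutedPercolation 3 1 1) (halfBox r) = (halfBox r).card + 1 := by
  refine le_antisymm (typicalMax_le_card_add_one _ _) ?_
  by_contra hlt
  push Not at hlt
  have hle : typicalMax (floorDilutedPercolation 3 1 1) (halfBox r) ≤ (halfBox r).card := by omega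
  have h1 := real_typicalMax_le_clusterMaxIn_le (floorDilutedPercolation 3 1 1) (halfBox r)
  have h2 : (1 : ℝ) ≤ (floorDilutedPercolation 3 1 1).real
      {ω | typicalMax (floorDilutedPercolation 3 1 1) (halfBox r) ≤ clusterMaxIn (halfBox r) ω} := by
    rw [← real_card_le_clusterMaxIn_one r]
    exact measureReal_mono (fun ω hω => le_trans hle hω) (measure_ne_top _ _)
  have h3 : Real.exp (-1) < 1 := Real.exp_lt_one_iff.2 (by norm_num)
  linarith

/-- `|Λ_r| ≥ (r+1)³` (the cube `{0,…,r}³` lies in the half-box). [folklore] -/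
theorem pow_three_le_card_halfBox (r : ℕ) : (r + 1) ^ 3 ≤ (halfBox r).card := by
  rw [← card_cube]
  exact Finset.card_le_card (cube_subset_halfBox r)

/-- **C⁺ is false without criticality**: for every `s < 3` there is no `C` with
`typicalMax P^ℍ_{1,1} Λ_r ≤ C r^s` for all `r ≥ 1` (the left side is `|Λ_r| + 1 ≥ (r+1)³ ≥ r³`). [folklore] -/
theorem not_halfBoxTypicalMax_one {s : ℝ} (hs : s < 3) :
    ¬ ∃ C : ℝ, ∀ r : ℕ, 1 ≤ r → (typicalMax (floorDilutedPercolation 3 1 1) (halfBox r) : ℝ) ≤ C * (r : ℝ) ^ s := by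
  rintro ⟨C, hC⟩
  refine not_forall_rpow_le (c := 1) (C := C) one_pos hs fun r hr => ?_
  have h3 : (r : ℝ) ^ (3 : ℝ) = (r : ℝ) ^ (3 : ℕ) := by exact_mod_cast Real.rpow_natCast (r : ℝ) 3
  have hM : ((r : ℝ) + 1) ^ 3 + 1 ≤ (typicalMax (floorDilutedPercolation 3 1 1) (halfBox r) : ℝ) := by
    rw [typicalMax_halfBox_one]
    have := pow_three_le_card_halfBox r
    push_cast
    exact_mod_cast Nat.add_le_add_right this 1
  have hr0 : (0 : ℝ) ≤ r := Nat.cast_nonneg r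
  have hmono : (r : ℝ) ^ (3 : ℕ) ≤ ((r : ℝ) + 1) ^ 3 := by gcongr; linarith
  calc 1 * (r : ℝ) ^ (3 : ℝ) = (r : ℝ) ^ (3 : ℕ) := by rw [one_mul, h3]
    _ ≤ (typicalMax (floorDilutedPercolation 3 1 1) (halfBox r) : ℝ) := by linarith
    _ ≤ C * (r : ℝ) ^ s := hC r hr

/-- **The registered stub's shape with `p_c` replaced by `p = 1` is false** (`11/4 < 3`): any proof of
`stub_halfBoxTypicalMax` must use `p ≤ p_c(ℤ³)` quantitatively. [folklore] -/
theorem stub_halfBoxTypicalMax_false_without_criticality :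
    ¬ ∃ s : ℝ, s < (11 : ℝ) / 4 ∧ ∃ C : ℝ, ∀ r : ℕ, 1 ≤ r →
      (typicalMax (floorDilutedPercolation 3 1 1) (halfBox r) : ℝ) ≤ C * (r : ℝ) ^ s := by
  rintro ⟨s, hs, hC⟩
  exact not_halfBoxTypicalMax_one (by linarith) hC

end Summit.CriticalPhenomena.PercolationContinuityZ3.Theorems.TallClusterMassBound.TightnessLine
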